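import Mathlib
import Literature.Analysis.FluidPDE.SawtoothCascade

/-!
# K2 — the PHASE map on class lattice states, the shell-transfer matrix, and the invariant PROFILE CONE («control»)

**REVISION v1.4 (planner ad-ideate-p4 g18, 2026-08-29; WO-p4-K2-7 / cert-design delta).**  §6.4 ADDED (targets only, nothing proved):
`combState`, `CombColumnCreation θ K s C`, `CombColumnLaw θ K₀ C` = analytic lemma E5 (the `ι 0` table of the S4 line of record,
`K2AssemblyS4.lean` v4/v5).  §0–§6.3 unchanged from v1.3 (the S4 copy stays verbatim-identical on the 44 shared defs).

**REVISION v1.3 (planner ad-ideate-p4 g18, 2026-08-29; vet `K2AssemblyS4-vet-p4g18.md` finding F1).**  §4 WINDOW FIX: the entry predicates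
`Transfer` / `DebrisCreation` / `DebrisTransfer` now quantify over input densities supported in the shell AND IN THE TRUNCATION WINDOW
(`SupportedInW s c K d`), and the V-type input state is window-truncated (`inputState … V p = truncW K (vPairState α p)`), exactly as the
engine (`wo_p4_k2_4.py`: basis `q[i,±]`, `i ∈ shell ∩ window`; children built from the `(2K+1)²` parent array).  In v1.2 a density at
`|k| = K+1` had input energy `cEnergy … 0 K = 0` but non-zero children, so every entry predicate — hence `RenewalConeInvariant` — was
unsatisfiable as typed.  No measured number changes (the kit sups ARE the corrected predicates); §5 proofs untouched; §6 text unchanged.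

planner ad-ideate-p4 gen 16 (lens «control», service F-p4g16-1), crux workfile on the dir of
stmt-AnomalousDissipation-19491; companion of the memo `K2ConeInvariant.md` (same dir) and successor of
`K2TypedSlotMap.lean` (g15: ONE line family, one slot) and `K2MaterialControl.md` v1.5 §3 (P1′-wide + P1″ + P2 + P3).
Arbiter A26-3 (b): "shell-PROFILE cone invariance … AND its analytic form … state it as a Lean signature".

WHAT IS TYPED HERE (everything over the one-family objects of `K2TypedSlotMap.lean`, reproduced in §0: `slotMap`/`sheetAmps`/`coeff`/
`transportPhase`/`energy`):
* §1 truncated CLASS STATES `ζ : ℤ → ℤ → ℂ` (coefficient at wavevector `(α+m, β+n)` of the Bloch class `(α, β)`),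
  their level-`ℓ` energy `cEnergy`, the CHILDREN re-framing `child` (index arithmetic; class `((α+pm)/2, (β+pn)/2)`);
* §2 the two slots of a phase, family by family through the one-family objects of `K2SlotMap`: H slot = rows
  `m` (family `(α+m, β)`, transverse profile from the row), V slot = columns `n` (family `(β+n, α)`, profile from the
  column) — transported part (`hTransport`, `vTransport`) and fresh sheet-pair densities (`hFresh`, `vFresh`), the
  sheet-pair embeddings `hPairState`/`vPairState` (= the engine's `SH`/`SV`);
* §3 the PHASE PIECES of the material bookkeeping: from a state entering a phase, the phase (H slot then V slot)
  produces a fresh straight V-pair (densities `freshV`, type V), a fresh H-pair V-transported once (densities `freshH`,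
  type H, "zigzag") and DEBRIS (`vTransport ∘ hTransport`, everything transported twice); `phaseTotal` = their sum;
* §4 dyadic SHELLS of the streamwise wavenumber of a sheet density (`shellLo`: 0, 0.64, 2, 4, 8, 16, …) and the
  SHELL-TRANSFER ENTRIES as sup-statements `Transfer α β θ K t s t' s' M`:
  "input piece of type `t` with densities in shell `s` ↦ (children, phase) ↦ output piece `(t', s')` has level-1 energy
  ≤ M² × input level-0 energy" — the numbers `M[(t',s'),(t,s)]` of kit WO-p4-K2-4 (`wo_p4_k2_4.py`) are exactly these sups
  (generalized eigenvalues), and `DebrisCreation` the debris column;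
* §5 the CONTROL ALGEBRA, proved: pieces bounded by a profile (`x ≤ g • ε`) and a sub-eigenvector inequality
  `M ε ≤ Λ ε` (the profile CONE is invariant) give `gauge` contraction by `Λ` per phase (`gauge_step`,
  `gauge_iterate`) and energy ≤ `(g Σ ε)²` by the triangle inequality (`norm_sum_le_of_profile`): this is the skeleton
  that turns K-uniform transfer entries into the cumulative geometric envelope of `K2PhaseGrowthClassicalH`;
* §5 also proves `renewal_gauge`: debris of every age feeding back (`x (n+1) ≤ M x n + Σ_k D_k x (n-k)`) under the
  RENEWAL CONE inequality `M ε + Σ_k ρ^{-k} D_k ε ≤ ρ ε` still gives `x n ≤ g ρ^n ε` — persistence without decay costs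
  only `D/(ρ-1)`;
* §6 the TARGET Props: `PhaseConeInvariant θ Λ S K₀` (an invariant profile cone with factor Λ on the first `S` shells of
  both types, uniformly in the truncation `K ≥ K₀` and the class), `RenewalConeInvariant θ ρ K₀` (the complete statement:
  all shells, fresh transfer AND age-`k` debris transfer `DebrisTransfer`/`debrisOut`, renewal cone), `StableBlockCreation θ a₀ C` (P1″ at block level: a
  stable family `|a| ≥ a₀` creates, from cascade-type sources, a pair of energy ≤ C²/|a| × source energy — the 1/|a| ENERGY
  law measured in WO-p4-K2-4's block table) and `OscillatoryDuhamelBound` (ad-lit L2's generic lemma: forced response of a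
  stable block at detuning ≥ Δ is ≤ (2‖A‖_∞ + ‖A′‖₁)/Δ, the integration-by-parts heart of P1″).
WHAT IS NOT: the identification of these lattice objects with the PDE of `K2PhaseGrowthClassicalH` (smooth field, δ_j > 0,
ν > 0) is S-2 of `K2MaterialControl.md` and stays INFORMAL; the V slot is typed with the same one-family map as the H slot
with the coordinate roles exchanged (engine convention, validated against p2's block norms); nothing in §6 is proved.
-/

set_option linter.dupNamespace false

noncomputable section

namespace Summit.AnomalousDissipation.AnomalousDissipation.Cruxes.K1LocalisedCascade.K2Cone

open Complex MeasureTheory intervalIntegral Finset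
open Literature.Analysis.FluidPDE.SawtoothCascade

/-! ## 0. The one-family objects of `K2TypedSlotMap.lean` (g15, commit 5cbecd5f08b7), reproduced (kernel sign as fixed by p2)

(`Cruxes/…` workfiles are not importable modules on the farm — `lean check` reports the import as unbuilt — so §1–§3 of
that file are copied here unchanged except for the ONE-CHARACTER kernel sign fix of p2's `K2SlotMapIdentities.lean` (see
`lineKernel`); the names agree, the namespace differs.) -/

section SlotMapCopy

/-! ### 0.1 Kernel, transport phase, Kelvin–Helmholtz block, explicit propagator -/

/-- The periodised Biot–Savart LINE KERNEL of the family with streamwise wavenumber `a` and transverse Bloch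
phase `β`: `G_{a,β}(y) = Σ_{n∈ℤ} e^{2πiβn} g(y - n)`, `g(y) = -e^{-κ|y|}/(2κ)`, `κ = 2π|a|`, in closed form on
`y = ⌊y⌋ + r`: `e^{2πiβ⌊y⌋} · (-(e^{-κr}/(1 - e^{-2πiβ}e^{-κ}) + e^{κ(r-1)} e^{2πiβ}/(1 - e^{2πiβ}e^{-κ}))/(2κ))`.
(`-G_{a,β}(y₀ - y)` is the stream function at height `y₀` of the unit vorticity mode `e^{2πiax} δ(· - y)`;
junk at `a = 0`, where it is only ever multiplied by `a`.)  SIGN: this is p2's CORRECTED term (`K2SlotMapIdentities.lean`, prover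
ad-k1loc-p2 g9: in g15's file the leading `-` bound only the first lattice branch; with the bracket fixed `KernelAtZero`/`KernelAtHalf`/
`BlockSq`/`PropagatorODE` are proved there from tree theorems p684501/p684727).  The kit engines of this memo (`Gfun` of `wo_p4_k2_4.py`,
g15's 3h engine) compute `-s/(2κ)` with `s` = the SUM of both branches, i.e. the corrected sign, so no number is affected. -/
def lineKernel (a β y : ℝ) : ℂ :=
  let κ : ℝ := 2 * Real.pi * |a|
  let r : ℝ := y - (⌊y⌋ : ℝ)
  let z : ℂ := Complex.exp (2 * Real.pi * β * Complex.I)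
  Complex.exp (2 * Real.pi * β * (⌊y⌋ : ℝ) * Complex.I) *
    ((-(((Real.exp (-(κ * r)) : ℂ) / (1 - (starRingEnd ℂ z) * (Real.exp (-κ) : ℂ)))
          + (Real.exp (κ * (r - 1)) : ℂ) * z / (1 - z * (Real.exp (-κ) : ℂ)))) / (2 * κ : ℂ))

/-- Transport multiplier of an H slot of total strain `θ` on the streamwise mode `a`:
`e^{2πiax} ζ₀(y) ↦ e^{2πia(x - θ·triWave y)} ζ₀(y)`. -/
def transportPhase (a θ y : ℝ) : ℂ :=
  Complex.exp (-(2 * Real.pi * a * θ * triWave y : ℝ) * Complex.I)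

/-- The 2 × 2 Kelvin–Helmholtz block of the kink-sheet pair `(q₊ on y = 1/4, q₋ on y = -1/4)`:
`X = 2πia · [[-1/4 - 2G(0), -2G(1/2)], [2 conj G(1/2), 1/4 + 2G(0)]]`, `G = lineKernel a β`
(diagonal = transport of each sheet by the shear at its own line ± self/partner induction; the tree's
`khField k β` is `X` with `2πG(0) = Σ₀`, `2π conj G(1/2) = S`). -/
def blockX (a β : ℝ) : Matrix (Fin 2) (Fin 2) ℂ :=
  ((2 * Real.pi * a : ℝ) * Complex.I : ℂ) •
    !![-(1 / 4 : ℂ) - 2 * lineKernel a β 0, -2 * lineKernel a β (1 / 2);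
       2 * starRingEnd ℂ (lineKernel a β (1 / 2)), (1 / 4 : ℂ) + 2 * lineKernel a β 0]

/-- `λ(a, β) = -a²·c²(a, β)`: the common eigenvalue-square of the block, `X² = λ • 1` (`BlockSq`);
`λ > 0` unstable (rate `√λ = sawSigma a β`), `λ < 0` stable, `λ = 0` neutral. -/
def khLam (a β : ℝ) : ℝ := -(a ^ 2 * sawC2 a β)

/-- `C(t)`: `cosh(√λ t)` / `cos(√(-λ) t)` / `1`. -/
def propC (a β t : ℝ) : ℝ :=
  if 0 < khLam a β then Real.cosh (Real.sqrt (khLam a β) * t)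
  else if khLam a β < 0 then Real.cos (Real.sqrt (-(khLam a β)) * t) else 1

/-- `Sn(t)`: `sinh(√λ t)/√λ` / `sin(√(-λ) t)/√(-λ)` / `t`. -/
def propSn (a β t : ℝ) : ℝ :=
  if 0 < khLam a β then Real.sinh (Real.sqrt (khLam a β) * t) / Real.sqrt (khLam a β)
  else if khLam a β < 0 then Real.sin (Real.sqrt (-(khLam a β)) * t) / Real.sqrt (-(khLam a β)) else t

/-- The explicit propagator `P(t) = e^{tX} = C(t)·1 + Sn(t)·X` (p2 `sheet_solution_eq`; `det P = 1`). -/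
def propagator (a β t : ℝ) : Matrix (Fin 2) (Fin 2) ℂ :=
  ((propC a β t : ℝ) : ℂ) • (1 : Matrix (Fin 2) (Fin 2) ℂ) + ((propSn a β t : ℝ) : ℂ) • blockX a β

/-! ### 0.2 Lamination states, forcing, Duhamel, the slot map -/

/-- S-4 state of ONE line family: an interior density profile on the period `[-1/2, 1/2)` (quasi-periodic
continuation with Bloch phase `β` understood) plus finitely many vortex SHEETS `(position yᵢ ∈ [-1/2,1/2),
amplitude cᵢ)`, i.e. the transverse density `ζ₀(y) + Σᵢ cᵢ δ(y - yᵢ)` of the streamwise mode `e^{2πiax}`. -/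
structure LamState where
  interior : ℝ → ℂ
  sheets : List (ℝ × ℂ)

/-- The pure interior mode `ζ₀ ≡ 1` (the transverse mode `n = 0` when `β = 0`): the comb remnant of P3. -/
def pureMode : LamState := ⟨fun _ => 1, []⟩

/-- A bare sheet pair on the kink lines with amplitudes `(q₊, q₋)` and no interior content. -/
def sheetPair (qp qm : ℂ) : LamState := ⟨fun _ => 0, [((1 / 4 : ℝ), qp), (-(1 / 4 : ℝ), qm)]⟩

/-- Forcing of the block at slot-time `s`: `f(s) = 2πia · (-2 ∫ G(1/4 - y) dμ_s(y), 2 ∫ G(-1/4 - y) dμ_s(y))`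
where `μ_s = transported state = (ζ₀(y) dy + Σ cᵢ δ_{yᵢ}) · e^{-2πias·triWave y}` — the transverse velocity the
transported content induces on the two kink lines, times the vorticity jump. -/
def forcing (a β : ℝ) (st : LamState) (s : ℝ) : Fin 2 → ℂ :=
  let src : ℝ → ℂ := fun y0 =>
    (∫ y in (-(1 / 2 : ℝ))..(1 / 2), lineKernel a β (y0 - y) * st.interior y * transportPhase a s y)
      + (st.sheets.map (fun p => lineKernel a β (y0 - p.1) * p.2 * transportPhase a s p.1)).sum
  ![((2 * Real.pi * a : ℝ) * Complex.I : ℂ) * (-2) * src (1 / 4),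
    ((2 * Real.pi * a : ℝ) * Complex.I : ℂ) * 2 * src (-(1 / 4))]

/-- Fresh sheet amplitudes after strain `θ` (Duhamel): `q(θ) = ∫₀^θ P(θ - s) f(s) ds`. -/
def sheetAmps (a β θ : ℝ) (st : LamState) : Fin 2 → ℂ :=
  ∫ s in (0 : ℝ)..θ, (propagator a β (θ - s)).mulVec (forcing a β st s)

/-- THE SLOT MAP on one line family (S-2): transported interior, transported old sheets, plus the fresh pair
`(1/4, q₊), (-1/4, q₋)`. -/
def slotMap (a β θ : ℝ) (st : LamState) : LamState :=
  ⟨fun y => st.interior y * transportPhase a θ y,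
   (st.sheets.map (fun p => (p.1, p.2 * transportPhase a θ p.1)))
     ++ [((1 / 4 : ℝ), sheetAmps a β θ st 0), (-(1 / 4 : ℝ), sheetAmps a β θ st 1)]⟩

/-! ### 0.3 Fourier coefficients and energy -/

/-- Transverse Fourier coefficient at `β + n`: `ζ̂(n) = ∫ ζ₀ e^{-2πi(β+n)y} dy + Σᵢ cᵢ e^{-2πi(β+n)yᵢ}`. -/
def coeff (β : ℝ) (st : LamState) (n : ℤ) : ℂ :=
  (∫ y in (-(1 / 2 : ℝ))..(1 / 2), st.interior y * Complex.exp (-(2 * Real.pi * (β + n) * y : ℝ) * Complex.I))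
    + (st.sheets.map (fun p => p.2 * Complex.exp (-(2 * Real.pi * (β + n) * p.1 : ℝ) * Complex.I))).sum

/-- Kinetic energy (velocity `L²` norm squared, up to the common factor) of the state on the family `(a, β)`:
`E = Σ_n |ζ̂(n)|² / (4π² (a² + (β + n)²))` (junk 0 if not summable; summable whenever the interior is
integrable, the coefficients being bounded and the weights `O(n⁻²)`). -/
def energy (a β : ℝ) (st : LamState) : ℝ :=
  ∑' n : ℤ, ‖coeff β st n‖ ^ 2 / (4 * Real.pi ^ 2 * (a ^ 2 + (β + n) ^ 2))


end SlotMapCopy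

/-! ## 1. Truncated class states, energy, children -/

/-- Lattice state of one Bloch class `(α, β)`: the vorticity Fourier coefficient at wavevector `(α + m, β + n)`. -/
abbrev CState : Type := ℤ → ℤ → ℂ

/-- The truncation window `[-K, K]`. -/
def win (K : ℕ) : Finset ℤ := Finset.Icc (-(K : ℤ)) K

/-- Kinetic energy at level `ℓ` (wavenumbers scaled by `2^ℓ`) of the truncated state:
`Σ_{|m|,|n| ≤ K} |ζ(m,n)|² / (4π² 4^ℓ ((α+m)² + (β+n)²))` (the zero mode, if present, contributes 0: `x / 0 = 0`). -/
def cEnergy (α β : ℝ) (ℓ K : ℕ) (ζ : CState) : ℝ :=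
  ∑ m ∈ win K, ∑ n ∈ win K, ‖ζ m n‖ ^ 2 / (4 * Real.pi ^ 2 * (4 : ℝ) ^ ℓ * ((α + m) ^ 2 + (β + n) ^ 2))

/-- CHILDREN re-framing (one cascade level down, period halves): the modes of class `(α, β)` with parities `(pm, pn)`
form the child class `((α + pm)/2, (β + pn)/2)` with `ζ_child(m, n) = ζ(2m + pm, 2n + pn)`. -/
def child (pm pn : ℤ) (ζ : CState) : CState := fun m n => ζ (2 * m + pm) (2 * n + pn)

/-- The child class of `(α, β)` with parities `(pm, pn)`. -/
def childClass (α β : ℝ) (pm pn : ℤ) : ℝ × ℝ := ((α + pm) / 2, (β + pn) / 2)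

/-- The parity set `{0, 1}`. -/
def parities : Finset ℤ := {0, 1}

/-! ## 2. The two slots of a phase, family by family -/

/-- The transverse profile `y ↦ Σ_{|n| ≤ K} c(n) e^{2πi(β+n)y}` of a truncated coefficient row. -/
def modeProfile (β : ℝ) (K : ℕ) (c : ℤ → ℂ) : ℝ → ℂ :=
  fun y => ∑ n ∈ win K, c n * Complex.exp ((2 * Real.pi * (β + n) * y : ℝ) * Complex.I)

/-- H slot (strain `θ`), TRANSPORTED part: row `m` is the family `(α + m, β)`; its profile is multiplied by
`transportPhase` and re-expanded (`K2SlotMap.coeff`), truncated to the window. -/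
def hTransport (α β θ : ℝ) (K : ℕ) (ζ : CState) : CState := fun m n' =>
  if m ∈ win K ∧ n' ∈ win K then
    coeff β ⟨fun y => modeProfile β K (ζ m) y * transportPhase (α + m) θ y, []⟩ n'
  else 0

/-- H slot, FRESH H-pair densities per row (`K2SlotMap.sheetAmps` of the row's family): `q m = (q₊, q₋)` on
`y = 1/4`, `y = -1/4`, streamwise wavenumber `α + m`. -/
def hFresh (α β θ : ℝ) (K : ℕ) (ζ : CState) : ℤ → Fin 2 → ℂ := fun m =>
  if m ∈ win K then sheetAmps (α + m) β θ ⟨modeProfile β K (ζ m), []⟩ else 0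

/-- Lattice state of an H-sheet pair with densities `q` (engine `SH`): `Z(m,n) = q₊(m) e^{-iπ(β+n)/2} + q₋(m) e^{iπ(β+n)/2}`. -/
def hPairState (β : ℝ) (q : ℤ → Fin 2 → ℂ) : CState := fun m n =>
  q m 0 * Complex.exp (-(Real.pi * (β + n) / 2 : ℝ) * Complex.I)
    + q m 1 * Complex.exp ((Real.pi * (β + n) / 2 : ℝ) * Complex.I)

/-- V slot (strain `θ`), TRANSPORTED part: column `n` is the family `(β + n, α)` (roles of the coordinates exchanged),
its profile over `x` read from the column. -/
def vTransport (α β θ : ℝ) (K : ℕ) (ζ : CState) : CState := fun m' n =>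
  if m' ∈ win K ∧ n ∈ win K then
    coeff α ⟨fun x => modeProfile α K (fun m => ζ m n) x * transportPhase (β + n) θ x, []⟩ m'
  else 0

/-- V slot, FRESH V-pair densities per column: `p n = (p₊, p₋)` on `x = 1/4`, `x = -1/4`, streamwise wavenumber `β + n`. -/
def vFresh (α β θ : ℝ) (K : ℕ) (ζ : CState) : ℤ → Fin 2 → ℂ := fun n =>
  if n ∈ win K then sheetAmps (β + n) α θ ⟨modeProfile α K (fun m => ζ m n), []⟩ else 0

/-- Lattice state of a V-sheet pair with densities `p` (engine `SV`): `Z(m,n) = p₊(n) e^{-iπ(α+m)/2} + p₋(n) e^{iπ(α+m)/2}`. -/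
def vPairState (α : ℝ) (p : ℤ → Fin 2 → ℂ) : CState := fun m n =>
  p n 0 * Complex.exp (-(Real.pi * (α + m) / 2 : ℝ) * Complex.I)
    + p n 1 * Complex.exp ((Real.pi * (α + m) / 2 : ℝ) * Complex.I)

/-! ## 3. Phase pieces (material bookkeeping of one phase = H slot then V slot at one level) -/

/-- The three pieces a phase produces from the state entering it. -/
structure PhasePieces where
  /-- densities of the fresh straight V-pair created in the V slot (type V). -/
  freshV : ℤ → Fin 2 → ℂ
  /-- densities of the fresh H-pair created in the H slot; at phase end its state is `vTransport (hPairState freshH)` (type H). -/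
  freshH : ℤ → Fin 2 → ℂ
  /-- debris: the entering state transported by both slots. -/
  debris : CState

/-- The phase pieces of class `(α, β)` at truncation `K` (strain `θ` per slot): `T = hTransport ζ`, `hq = hFresh ζ`,
the V slot acts on `T + hPairState hq`; fresh V densities from the whole of it, debris = `vTransport T`. -/
def phasePieces (α β θ : ℝ) (K : ℕ) (ζ : CState) : PhasePieces :=
  let T : CState := hTransport α β θ K ζ
  let hq : ℤ → Fin 2 → ℂ := hFresh α β θ K ζ
  let S : CState := fun m n => T m n + hPairState β hq m n
  ⟨vFresh α β θ K S, hq, vTransport α β θ K T⟩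

/-- The total state at phase end: fresh V pair + V-transported fresh H pair + debris. -/
def phaseTotal (α β θ : ℝ) (K : ℕ) (ζ : CState) : CState := fun m n =>
  let pc := phasePieces α β θ K ζ
  vPairState α pc.freshV m n + vTransport α β θ K (hPairState β pc.freshH) m n + pc.debris m n

/-! ## 4. Shells and the shell-transfer entries -/

/-- Lower edges of the shells of `|streamwise wavenumber|` of a sheet density: `S0 = [0, 0.64)` (KH band),
`S1 = [0.64, 2)`, `S(s) = [2^(s-1), 2^s)` for `s ≥ 2`. -/
def shellLo : ℕ → ℝ
  | 0 => 0
  | 1 => 16 / 25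
  | (s + 2) => (2 : ℝ) ^ (s + 1)

/-- Upper edge of shell `s`. -/
def shellHi (s : ℕ) : ℝ := shellLo (s + 1)

/-- `x` lies in shell `s`. -/
def InShell (s : ℕ) (x : ℝ) : Prop := shellLo s ≤ |x| ∧ |x| < shellHi s

/-- The two piece types carrying a shell profile: fresh straight V pairs and once-transported H pairs. -/
inductive PType
  | V
  | H
  deriving DecidableEq, Fintype

/-- Densities restricted to shell `s` (offset `c` = the class coordinate along the sheet). -/
def restrictShell (s : ℕ) (c : ℝ) (d : ℤ → Fin 2 → ℂ) : ℤ → Fin 2 → ℂ :=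
  fun (k : ℤ) => if shellLo s ≤ |c + (k : ℝ)| ∧ |c + (k : ℝ)| < shellHi s then d k else 0

/-- "the densities `d` are supported in shell `s`". -/
def SupportedIn (s : ℕ) (c : ℝ) (d : ℤ → Fin 2 → ℂ) : Prop := ∀ k : ℤ, ¬ InShell s (c + (k : ℝ)) → d k = 0

/-- v1.3: "the densities `d` are supported in shell `s` AND in the truncation window `|k| ≤ K`" (the engine's input basis). -/
def SupportedInW (s : ℕ) (c : ℝ) (K : ℕ) (d : ℤ → Fin 2 → ℂ) : Prop :=
  SupportedIn s c d ∧ ∀ k : ℤ, k ∉ win K → d k = 0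

/-- v1.3: truncation of a class state to the window `|m|, |n| ≤ K` (the engine's `(2K+1)²` arrays). -/
def truncW (K : ℕ) (ζ : CState) : CState :=
  fun (m n : ℤ) => if m ∈ win K ∧ n ∈ win K then ζ m n else 0

/-- The lattice state, at phase ENTRY (class `(α, β)`, level 0), of an input piece of type `t` with densities `d`:
a straight V pair (v1.3: window-truncated, as the engine's `SV` on the `(2K+1)²` lattice), resp. an H pair V-transported once
(created in the previous H slot of the same level; `vTransport` is windowed already). -/
def inputState (α β θ : ℝ) (K : ℕ) : PType → (ℤ → Fin 2 → ℂ) → CState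
  | PType.V, p => truncW K (vPairState α p)
  | PType.H, q => vTransport α β θ K (hPairState β q)

/-- The class coordinate along the sheets of type `t`: `β` for V pairs (densities in `β + n`), `α` for H pairs. -/
def alongCoord (α β : ℝ) : PType → ℝ
  | PType.V => β
  | PType.H => α

/-- Level-`ℓ` energy of the output piece `(t', s')` among the phase pieces `pc` of a class `(α', β')` sitting at level `ℓ`. -/
def outEnergyAt (α' β' θ : ℝ) (K ℓ : ℕ) (s' : ℕ) (pc : PhasePieces) : PType → ℝ
  | PType.V => cEnergy α' β' ℓ K (vPairState α' (restrictShell s' β' pc.freshV))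
  | PType.H => cEnergy α' β' ℓ K (vTransport α' β' θ K (hPairState β' (restrictShell s' α' pc.freshH)))

/-- Level-1 energy of the output piece `(t', s')` among the phase pieces `pc` of the child class `(α', β')`. -/
def outEnergy (α' β' θ : ℝ) (K : ℕ) (s' : ℕ) (pc : PhasePieces) : PType → ℝ :=
  outEnergyAt α' β' θ K 1 s' pc

/-- SHELL-TRANSFER ENTRY `M[(t', s'), (t, s)] ≤ M` for the parent class `(α, β)` at truncation `K`:
every input piece of type `t` with densities in shell `s` produces, summed over the four children and after their
phase, an output piece `(t', s')` of level-1 energy ≤ `M²` × its own level-0 energy.  (WO-p4-K2-4 computes the sup.) -/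
def Transfer (α β θ : ℝ) (K : ℕ) (t : PType) (s : ℕ) (t' : PType) (s' : ℕ) (M : ℝ) : Prop :=
  ∀ d : ℤ → Fin 2 → ℂ, SupportedInW s (alongCoord α β t) K d →
    (∑ pm ∈ parities, ∑ pn ∈ parities,
        outEnergy ((α + pm) / 2) ((β + pn) / 2) θ K s'
          (phasePieces ((α + pm) / 2) ((β + pn) / 2) θ K (child pm pn (inputState α β θ K t d))) t')
      ≤ M ^ 2 * cEnergy α β 0 K (inputState α β θ K t d)

/-- DEBRIS column `m_O[(t, s)] ≤ mO`: the twice-transported remainder produced from an input piece `(t, s)`. -/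
def DebrisCreation (α β θ : ℝ) (K : ℕ) (t : PType) (s : ℕ) (mO : ℝ) : Prop :=
  ∀ d : ℤ → Fin 2 → ℂ, SupportedInW s (alongCoord α β t) K d →
    (∑ pm ∈ parities, ∑ pn ∈ parities,
        cEnergy ((α + pm) / 2) ((β + pn) / 2) 1 K
          (phasePieces ((α + pm) / 2) ((β + pn) / 2) θ K (child pm pn (inputState α β θ K t d))).debris)
      ≤ mO ^ 2 * cEnergy α β 0 K (inputState α β θ K t d)

/-- DEBRIS LINEAGE OUTPUT.  `debrisOut θ K t' s' k ℓ α β ζ` = the energy, at level `ℓ + k + 1` and summed over all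
`4^(k+1)` descendant classes, of the output piece `(t', s')` produced by content `ζ` of class `(α, β)` (level `ℓ`) that
travels the DEBRIS path (children ↦ transported by both slots) for `k` phases and then passes one full phase;
`k = 0` is the quantity bounded in `Transfer`.  (WO-p4-K2-4b, `wo_p4_k2_4b.py`, measures the sups for ages `k ≤ 3`.) -/
def debrisOut (θ : ℝ) (K : ℕ) (t' : PType) (s' : ℕ) : ℕ → ℕ → ℝ → ℝ → CState → ℝ
  | 0, ℓ, α, β, ζ => ∑ pm ∈ parities, ∑ pn ∈ parities,
      outEnergyAt ((α + pm) / 2) ((β + pn) / 2) θ K (ℓ + 1) s'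
        (phasePieces ((α + pm) / 2) ((β + pn) / 2) θ K (child pm pn ζ)) t'
  | (k + 1), ℓ, α, β, ζ => ∑ pm ∈ parities, ∑ pn ∈ parities,
      debrisOut θ K t' s' k (ℓ + 1) ((α + pm) / 2) ((β + pn) / 2)
        (phasePieces ((α + pm) / 2) ((β + pn) / 2) θ K (child pm pn ζ)).debris

/-- RENEWAL (DEBRIS-TRANSFER) ENTRY of age `k ≥ 1`: `D_k[(t', s'), (t, s)] ≤ D` for the parent class `(α, β)` —
the age-`k` debris of an input piece `(t, s)` produces output pieces `(t', s')` of energy ≤ `D²` × the input energy.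
No decay in `k` is asked for (the data show persistence, `O→O ≈ 1`, for KH-band debris): the renewal cone below only
needs the entries bounded, uniformly in the age. -/
def DebrisTransfer (α β θ : ℝ) (K k : ℕ) (t : PType) (s : ℕ) (t' : PType) (s' : ℕ) (D : ℝ) : Prop :=
  ∀ d : ℤ → Fin 2 → ℂ, SupportedInW s (alongCoord α β t) K d →
    debrisOut θ K t' s' k 0 α β (inputState α β θ K t d) ≤ D ^ 2 * cEnergy α β 0 K (inputState α β θ K t d)

/-! ## 5. The control algebra: profile cone ⇒ gauge contraction ⇒ energy envelope (proved) -/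

/-- ONE PHASE OF THE GAUGE.  Pieces `x ≥ 0` bounded by the profile, `x ≤ g • ε`; new pieces bounded linearly,
`y ≤ M x` with `M ≥ 0`; the profile is a sub-eigenvector, `M ε ≤ Λ ε` (the cone `{x ≤ g ε}` is mapped into
`{y ≤ Λ g ε}`): then `y ≤ (Λ g) • ε`. -/
theorem gauge_step {ι : Type*} [Fintype ι] {M : ι → ι → ℝ} {ε x y : ι → ℝ} {g Λ : ℝ}
    (hM : ∀ i j, 0 ≤ M i j) (hg : 0 ≤ g) (hx : ∀ j, x j ≤ g * ε j)
    (hstep : ∀ i, y i ≤ ∑ j, M i j * x j) (hcone : ∀ i, ∑ j, M i j * ε j ≤ Λ * ε i) :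
    ∀ i, y i ≤ (Λ * g) * ε i := by
  intro i
  calc y i ≤ ∑ j, M i j * x j := hstep i
    _ ≤ ∑ j, M i j * (g * ε j) := by
        apply Finset.sum_le_sum
        intro j _
        exact mul_le_mul_of_nonneg_left (hx j) (hM i j)
    _ = g * ∑ j, M i j * ε j := by
        rw [Finset.mul_sum]
        apply Finset.sum_congr rfl
        intro j _
        ring
    _ ≤ g * (Λ * ε i) := mul_le_mul_of_nonneg_left (hcone i) hg
    _ = (Λ * g) * ε i := by ring

/-- ONE PHASE WITH A DEBRIS FEED: `y ≤ M x + D` gives `y ≤ (Λ g) • ε + D`. -/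
theorem gauge_step_debris {ι : Type*} [Fintype ι] {M : ι → ι → ℝ} {ε x y D : ι → ℝ} {g Λ : ℝ}
    (hM : ∀ i j, 0 ≤ M i j) (hg : 0 ≤ g) (hx : ∀ j, x j ≤ g * ε j)
    (hstep : ∀ i, y i ≤ (∑ j, M i j * x j) + D i) (hcone : ∀ i, ∑ j, M i j * ε j ≤ Λ * ε i) :
    ∀ i, y i ≤ (Λ * g) * ε i + D i := by
  have h := gauge_step (y := fun i => y i - D i) hM hg hx (fun i => by linarith [hstep i]) hcone
  intro i
  have := h i
  linarith

/-- THE CASCADE OF THE GAUGE: along a sequence of phases with the same transfer bound and invariant profile,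
`x L ≤ (Λ^L g) • ε`. -/
theorem gauge_iterate {ι : Type*} [Fintype ι] {M : ι → ι → ℝ} {ε : ι → ℝ} {x : ℕ → ι → ℝ} {g Λ : ℝ}
    (hM : ∀ i j, 0 ≤ M i j) (hg : 0 ≤ g) (hΛ : 0 ≤ Λ) (hx0 : ∀ j, x 0 j ≤ g * ε j)
    (hstep : ∀ L i, x (L + 1) i ≤ ∑ j, M i j * x L j) (hcone : ∀ i, ∑ j, M i j * ε j ≤ Λ * ε i) :
    ∀ L i, x L i ≤ (Λ ^ L * g) * ε i := by
  intro L
  induction L with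
  | zero => intro i; simpa using hx0 i
  | succ L ih =>
      intro i
      have hgL : 0 ≤ Λ ^ L * g := mul_nonneg (pow_nonneg hΛ L) hg
      have := gauge_step (x := x L) (y := x (L + 1)) (g := Λ ^ L * g) hM hgL ih (hstep L) hcone i
      calc x (L + 1) i ≤ (Λ * (Λ ^ L * g)) * ε i := this
        _ = (Λ ^ (L + 1) * g) * ε i := by ring

/-- ENERGY FROM THE GAUGE (triangle inequality): pieces `v i` of a normed group with `‖v i‖ ≤ g ε i` have
`‖Σ v i‖ ≤ g Σ ε i`; with `gauge_iterate` this is the cumulative geometric envelope `E_L^{1/2} ≤ Λ^L g Σε`. -/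
theorem norm_sum_le_of_profile {E : Type*} [SeminormedAddCommGroup E] {ι : Type*} [Fintype ι]
    (v : ι → E) (ε : ι → ℝ) (g : ℝ) (h : ∀ i, ‖v i‖ ≤ g * ε i) :
    ‖∑ i, v i‖ ≤ g * ∑ i, ε i := by
  calc ‖∑ i, v i‖ ≤ ∑ i, ‖v i‖ := norm_sum_le _ _
    _ ≤ ∑ i, g * ε i := Finset.sum_le_sum fun i _ => h i
    _ = g * ∑ i, ε i := by rw [Finset.mul_sum]

/-- COLLATZ–WIELANDT form of the cone condition: if `ε > 0` then `M ε ≤ Λ ε` says the weighted row sums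
`Σ_j M i j ε j / ε i` are ≤ Λ, i.e. `Λ` bounds the `ℓ^∞_{1/ε}` operator norm of `M`; the best `Λ` over
profiles is the Perron root of `M` (not proved here; this direction is what the recursion uses). -/
theorem cone_of_rowsum {ι : Type*} [Fintype ι] {M : ι → ι → ℝ} {ε : ι → ℝ} {Λ : ℝ}
    (hε : ∀ i, 0 < ε i) (hrow : ∀ i, (∑ j, M i j * ε j) / ε i ≤ Λ) :
    ∀ i, ∑ j, M i j * ε j ≤ Λ * ε i := by
  intro i
  have := hrow i
  rwa [div_le_iff₀ (hε i)] at this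

/-- RENEWAL FORM OF THE GAUGE CASCADE (debris of every age feeds back, no decay assumed): if fresh pieces obey
`x (n+1) ≤ M x n + Σ_{k=1}^{n} D_k x (n-k)` and the profile satisfies the RENEWAL CONE inequality
`M ε + Σ_{k≥1} ρ^{-k} D_k ε ≤ ρ ε` (all partial sums), then `x n ≤ g ρ^n ε`. -/
theorem renewal_gauge {ι : Type*} [Fintype ι] {M : ι → ι → ℝ} {D : ℕ → ι → ι → ℝ} {ε : ι → ℝ}
    {x : ℕ → ι → ℝ} {g ρ : ℝ}
    (hM : ∀ i j, 0 ≤ M i j) (hD : ∀ k i j, 0 ≤ D k i j) (hg : 0 ≤ g) (hρ : 0 < ρ)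
    (hx0 : ∀ i, x 0 i ≤ g * ε i)
    (hstep : ∀ n i, x (n + 1) i ≤
        (∑ j, M i j * x n j) + ∑ k ∈ Finset.range n, ∑ j, D (k + 1) i j * x (n - (k + 1)) j)
    (hcone : ∀ n i,
        (∑ j, M i j * ε j) + (∑ k ∈ Finset.range n, (ρ ^ (k + 1))⁻¹ * ∑ j, D (k + 1) i j * ε j) ≤ ρ * ε i) :
    ∀ n i, x n i ≤ (g * ρ ^ n) * ε i := by
  have key : ∀ n, ∀ m, m ≤ n → ∀ i, x m i ≤ (g * ρ ^ m) * ε i := by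
    intro n
    induction n with
    | zero =>
        intro m hm i
        have h0 : m = 0 := by omega
        subst h0
        simpa using hx0 i
    | succ n ih =>
        intro m hm i
        rcases Nat.lt_or_ge m (n + 1) with h | h
        · exact ih m (by omega) i
        · have hm' : m = n + 1 := by omega
          subst hm'
          have hρ0 : ρ ≠ 0 := ne_of_gt hρ
          -- bound the fresh term
          have h1 : ∑ j, M i j * x n j ≤ ∑ j, M i j * ((g * ρ ^ n) * ε j) := by
            apply Finset.sum_le_sum
            intro j _
            exact mul_le_mul_of_nonneg_left (ih n le_rfl j) (hM i j)
          -- bound the renewal terms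
          have h2 : ∑ k ∈ Finset.range n, ∑ j, D (k + 1) i j * x (n - (k + 1)) j
              ≤ ∑ k ∈ Finset.range n, ∑ j, D (k + 1) i j * ((g * ρ ^ (n - (k + 1))) * ε j) := by
            apply Finset.sum_le_sum
            intro k hk
            apply Finset.sum_le_sum
            intro j _
            have hk' : k < n := Finset.mem_range.mp hk
            exact mul_le_mul_of_nonneg_left (ih (n - (k + 1)) (by omega) j) (hD (k + 1) i j)
          -- rewrite ρ^(n-(k+1)) = ρ^n (ρ^(k+1))⁻¹
          have h3 : ∀ k ∈ Finset.range n,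
              ∑ j, D (k + 1) i j * ((g * ρ ^ (n - (k + 1))) * ε j)
                = (g * ρ ^ n) * ((ρ ^ (k + 1))⁻¹ * ∑ j, D (k + 1) i j * ε j) := by
            intro k hk
            have hk' : k + 1 ≤ n := by
              have := Finset.mem_range.mp hk
              omega
            rw [pow_sub₀ ρ hρ0 hk', Finset.mul_sum, Finset.mul_sum]
            apply Finset.sum_congr rfl
            intro j _
            field_simp
          have h4 : ∑ j, M i j * ((g * ρ ^ n) * ε j) = (g * ρ ^ n) * ∑ j, M i j * ε j := by
            rw [Finset.mul_sum]
            apply Finset.sum_congr rfl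
            intro j _
            ring
          have hgn : 0 ≤ g * ρ ^ n := mul_nonneg hg (pow_nonneg hρ.le n)
          calc x (n + 1) i
              ≤ (∑ j, M i j * x n j) + ∑ k ∈ Finset.range n, ∑ j, D (k + 1) i j * x (n - (k + 1)) j :=
                hstep n i
            _ ≤ (∑ j, M i j * ((g * ρ ^ n) * ε j))
                  + ∑ k ∈ Finset.range n, ∑ j, D (k + 1) i j * ((g * ρ ^ (n - (k + 1))) * ε j) :=
                add_le_add h1 h2
            _ = (g * ρ ^ n) * ((∑ j, M i j * ε j)
                  + ∑ k ∈ Finset.range n, (ρ ^ (k + 1))⁻¹ * ∑ j, D (k + 1) i j * ε j) := by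
                rw [h4, Finset.sum_congr rfl h3, ← Finset.mul_sum, mul_add]
            _ ≤ (g * ρ ^ n) * (ρ * ε i) := mul_le_mul_of_nonneg_left (hcone n i) hgn
            _ = (g * ρ ^ (n + 1)) * ε i := by ring
  intro n i
  exact key n n le_rfl i

/-! ## 6. Target statements (nothing below is proved) -/

/-- The index set of the profile: piece type × shell index `< S`. -/
abbrev PIdx (S : ℕ) : Type := PType × Fin S

/-- **THE INVARIANT PROFILE CONE** (P1′-wide + P1″ of the memo in one statement, K-uniform form).  For slots of
strain `θ` there are a positive profile `ε` on (type, shell < `S`), a nonnegative matrix `M` and a factor `Λ` such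
that, for every truncation `K ≥ K₀` and every class `(α, β) ∈ [0,1)²`, each shell-transfer entry is bounded by `M`
(`Transfer`) and `M ε ≤ Λ ε`.  With `S` large enough that shell `S-1` exceeds the truncation this covers all
densities; WO-p4-K2-4 measures `M` (K = 24/32/48) and the Perron profile.  The assembly wants `Λ < 59.62 = 5 e^{8σ⋆}`
after the debris/decoherence term (P2) is added through `gauge_step_debris`. -/
def PhaseConeInvariant (θ Λ : ℝ) (S K₀ : ℕ) : Prop :=
  ∃ ε : PIdx S → ℝ, (∀ i, 0 < ε i) ∧
    ∃ M : PIdx S → PIdx S → ℝ, (∀ i j, 0 ≤ M i j) ∧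
      (∀ K : ℕ, K₀ ≤ K → ∀ α β : ℝ, α ∈ Set.Ico (0 : ℝ) 1 → β ∈ Set.Ico (0 : ℝ) 1 →
        ∀ i j : PIdx S, Transfer α β θ K j.1 j.2 i.1 i.2 (M i j)) ∧
      (∀ i : PIdx S, ∑ j, M i j * ε j ≤ Λ * ε i)

/-- **THE RENEWAL CONE** (the complete K-uniform bookkeeping statement: fresh transfer + debris of every age, no
decay assumed).  Profile `ε > 0` on (type, shell) — ALL shells, so that every truncation is covered — a fresh-transfer
matrix `M`, renewal matrices `D k` (`k ≥ 1`) and a rate `ρ` such that, uniformly in `K ≥ K₀` and the class: the entries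
bound `Transfer` / `DebrisTransfer`, only finitely many columns are inhabited at each truncation (so all sums below are
finite sums in disguise), and the RENEWAL CONE inequality `M ε + Σ_{k≥1} ρ^{-k} D_k ε ≤ ρ ε` holds for all partial
sums.  By `renewal_gauge` + `norm_sum_le_of_profile` this yields `E_L^{1/2} ≤ ρ^L · g · Σε`, i.e. the envelope of
`K2PhaseGrowthClassicalH` with constant `ρ e^{-8σ⋆}` (target: `ρ < 59.62`; measured main part `Λ ≤ 23.7` per class,
`≤ 32.6` class-uniform, renewal correction `D/(ρ-1) < 1`). -/
def RenewalConeInvariant (θ ρ : ℝ) (K₀ : ℕ) : Prop :=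
  ∃ ε : PType × ℕ → ℝ, (∀ i, 0 < ε i) ∧
    ∃ (M : (PType × ℕ) → (PType × ℕ) → ℝ) (D : ℕ → (PType × ℕ) → (PType × ℕ) → ℝ),
      (∀ i j, 0 ≤ M i j) ∧ (∀ k i j, 0 ≤ D k i j) ∧
      (∀ K : ℕ, K₀ ≤ K → ∀ α β : ℝ, α ∈ Set.Ico (0 : ℝ) 1 → β ∈ Set.Ico (0 : ℝ) 1 →
        ∀ i j : PType × ℕ, Transfer α β θ K j.1 j.2 i.1 i.2 (M i j) ∧
          ∀ k : ℕ, 1 ≤ k → DebrisTransfer α β θ K k j.1 j.2 i.1 i.2 (D k i j)) ∧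
      (∀ (S : Finset (PType × ℕ)) (n : ℕ) (i : PType × ℕ),
        (∑ j ∈ S, M i j * ε j) + (∑ k ∈ Finset.range n, (ρ ^ (k + 1))⁻¹ * ∑ j ∈ S, D (k + 1) i j * ε j) ≤ ρ * ε i)

/-- **P1″ AT BLOCK LEVEL (the 1/|a| energy law of stable-block creation).**  On a family with streamwise wavenumber
`|a| ≥ a₀` (stable Kelvin–Helmholtz block) a slot of strain `θ` creates, from interior content whose transverse
spectrum is of CASCADE TYPE (`|β + n| ≤ |a|/8 + 2`: such content un-tilts only near the START of the slot, as the
chevron-scattered parent and the fresh sheets of the cascade do), a sheet pair of energy ≤ `C²/|a|` × the content's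
energy.  Mechanism: the block rotates at frequency `π|a|/2 − 1` (edge-wave shift of the kink sheet: `2πa·2G_a(0) →
−sgn(a)`), the forcing is co-moving at `π|a|/2` with a `1/√(1+t²)` corner pulse of height `∝ 1/|a|` (kernel mass
`1/(4π²a²)` × coupling `4π|a|`): detuning exactly 1, whence `|q| ≲ 0.4·|source|/|a|` and energy ratio `∝ 1/|a|`.
WO-p4-K2-4's block table reports `√|a| × (creation amplitude sup)` for KH-row / low / cascade-type / all sources. -/
def StableBlockCreation (θ a₀ C : ℝ) : Prop :=
  ∀ a β : ℝ, a₀ ≤ |a| → β ∈ Set.Ico (0 : ℝ) 1 → ∀ K : ℕ, ∀ c : ℤ → ℂ,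
    (∀ n : ℤ, |a| / 8 + 2 < |β + n| → c n = 0) →
      energy a β (sheetPair (sheetAmps a β θ ⟨modeProfile β K c, []⟩ 0) (sheetAmps a β θ ⟨modeProfile β K c, []⟩ 1))
        ≤ C ^ 2 / |a| * energy a β ⟨modeProfile β K c, []⟩

/-- **THE GENERIC STABLE-BLOCK RESPONSE LEMMA** (ad-lit L2; the integration-by-parts heart of P1″): for a stable
propagator pair `C = cos(ω·)`, and a forcing `e^{iφs} A(s)` with `C¹` envelope and detuning `|φ| − ω ≥ Δ > 0`,
`‖∫₀^θ cos(ω s) e^{iφ s} A(s) ds‖ ≤ (2 sup|A| + ∫₀^θ |A′|)/Δ` (and the same with `sin(ω s)/ω` against `1/(ωΔ)`).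
Combined with p2's Duhamel formula `sheet_forced_solution_eq` (p681197) this bounds the fresh amplitudes of a stable
family by the envelope variation of the forcing over the detuning, uniformly in the slot length. -/
def OscillatoryDuhamelBound : Prop :=
  ∀ (ω φ Δ θ : ℝ) (A : ℝ → ℂ) (A' : ℝ → ℂ), 0 < Δ → 0 ≤ θ → Δ ≤ |φ| - |ω| →
    (∀ s, HasDerivAt A (A' s) s) → Continuous A' →
      ‖∫ s in (0 : ℝ)..θ, (Real.cos (ω * s) : ℂ) * Complex.exp ((φ * s : ℝ) * Complex.I) * A s‖
        ≤ (2 * (⨆ s ∈ Set.Icc (0 : ℝ) θ, ‖A s‖) + ∫ s in (0 : ℝ)..θ, ‖A' s‖) / Δ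

/-! ### 6.4 (v1.4) E5 — the COMB-COLUMN creation law (profile-cost table `ι 0` of the S4 line; cert-design delta §2/§5)

The `hz = true` shear comb of route-2 (`ShearCombDatum`, vorticity modes `(0, b)`, `b` odd) meets the lone V half-slot of its injection
phase; column `b` is the `ξ = 0` interior mode on the line `a = b` (`vFresh`: source profile `fun m => ζ m b` = the single mode `m = 0`), so the
created pair is `c_b • sheetAmps b 0 θ (singleMode 0)` — p2 g10's `K2StableCreation.lean` object.  Measured (engine, `KHrows`, j321804 /
WO-p4-K2-7): created amplitude per unit column amplitude `1.177, 0.593, 0.455, 0.307` for shells 1–4 (`≈ 1.18·|b|^{-1/2}`); the S4 line of record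
loads `ι 0 (V,s) = (63/50)·2^{-(s-1)/2}`.  Mechanism (cert delta §5): on the KH-stable line `a = b` the Duhamel forcing is resonant where the
Doppler frequency `2πa·tri(y)` meets `∓ω(a)`, a layer of measure `≍ 1/(|a|θ)` next to the sheets ⇒ created ENERGY `≲ θ/|a|` × source energy.
p2's by-name bound (`sheetAmps_singleMode_norm_le_0/1`, uniform IBP) has this exponent with constant ≈ 53 in these units (A26-12); the
budget of the S4 line tolerates `C ≤ 2.4` in `CombColumnLaw 8 K₀ C` for the tail `s ≥ 7` (columns `|b| ≤ 63` are certified numerically). -/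

/-- The lattice state of an `hz = true` comb with column coefficients `c` (modes `(0, n)`, class `(0,0)` of its level). -/
def combState (c : ℤ → ℂ) : CState := fun m n => if m = 0 then c n else 0

/-- **COMB-COLUMN CREATION ENTRY** `ι 0 (V, s) ≤ C` at strain `θ`, truncation `K`: every comb supported on columns of shell `s` creates, in
the V half-slot, a straight V pair of (same-level) energy ≤ `C²` × the comb's energy.  (Shell `s ≥ 1` in use; column `n = 0` creates nothing.) -/
def CombColumnCreation (θ : ℝ) (K : ℕ) (s : ℕ) (C : ℝ) : Prop :=
  ∀ c : ℤ → ℂ, (∀ n : ℤ, ¬ InShell s ((n : ℤ) : ℝ) → c n = 0) →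
    cEnergy 0 0 0 K (vPairState 0 (vFresh 0 0 θ K (combState c))) ≤ C ^ 2 * cEnergy 0 0 0 K (combState c)

/-- **E5 — COMB-COLUMN LAW** (K-uniform): `ι 0 (V, s) ≤ C·2^{-(s-1)/2}` for every shell `s ≥ 1` and every truncation `K ≥ K₀`.
Of record for the S4 line: `θ = 8`, `C = 63/50`. -/
def CombColumnLaw (θ : ℝ) (K₀ : ℕ) (C : ℝ) : Prop :=
  ∀ K : ℕ, K₀ ≤ K → ∀ s : ℕ, 1 ≤ s → CombColumnCreation θ K s (C * (Real.sqrt 2)⁻¹ ^ (s - 1))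

end Summit.AnomalousDissipation.AnomalousDissipation.Cruxes.K1LocalisedCascade.K2Cone
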